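import Mathlib
import Literature.AlgebraicGeometry.Resolution.AffineBlowupAlgebra
import Literature.AlgebraicGeometry.Resolution.BlowupChartQuasiRegular
import HarnessLib

/-!
# Rees chart rings at a non-generator `T ∈ I` and the element `θ = (H₃t²)/(Tt)²` (generic, for the twisted root chart)

(crux stmt-ResolutionOfSingularities-15640 `WildQuotients.WildQuotientResolution`, line `Sketch`,
sector `|G| = p`; programme V4U of `L/w45c/CHAIN.md` v6 §4 row stub-2 (T2); [OURS · L1 W4.5c] — NOT a
statement of any manuscript; replaces the role of no printed item.)

For `I = (g₁,…,g_m) ⊆ R = k[x₁,…,xₙ]`, `T ∈ I` (not necessarily one of the `g_j`) and `H₃ ∈ I²`, the Rees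
chart ring `B = (R[It])_{(Tt)}` (Literature `reesChartBase`, `reesChart`, `reesChartEquiv`) contains the
chart generators `(g_jt)/(Tt)` and the degree-two fraction `θ = (H₃t²)/(Tt)²`; this file records their
images `g_j/T`, `H₃/T²` under `reesChart : B → R[1/T]`, the identity `(xtᴺ)/(Tt)ᴺ · Tᴺ/1 = r/1`, and
**`ringHom_ext_of_reesChart`**: two ring maps out of a localisation of `B` that agree on `R` (and send
`T` to a non-zero-divisor) are equal. V4U use (V4U-DESIGN §3): `I = I₆`, `T = T'`, `H₃ = H'³`,
`W_T = D₊(T't) ∩ D(θ)` the `σ`-stable affine piece at the `μ₂`-vertex of `Bl_{I₆} 𝔸ⁿ`.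
-/

-- single-problem summit: the doubled namespace component `ResolutionOfSingularities` is forced
set_option linter.dupNamespace false

noncomputable section

open MvPolynomial IsLocalization Polynomial HomogeneousLocalization Literature.AlgebraicGeometry.Resolution

namespace Summit.ResolutionOfSingularities.ResolutionOfSingularities.Theorems.WildQuotientResolution.JordanFour

section TwistEngine

/-! ### §(b) The engine: a Rees chart ring localised at `θ = (H₃t²)/(Tt)²`, twisted by `ψ` -/

variable (k : Type) [Field k] (n : ℕ) (a b c d : Fin n) {m : ℕ} (g : Fin m → MvPolynomial (Fin n) k)
  (T : MvPolynomial (Fin n) k) (hT : T ∈ Ideal.span (Set.range g)) (H₃ : MvPolynomial (Fin n) k)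
  (hH₃ : H₃ ∈ Ideal.span (Set.range g) ^ 2)

local notation3 "Ig" => Ideal.span (Set.range g)
local notation3 "Qp" => (1 - 3 * X b * X a + X a ^ 2 * X d : MvPolynomial (Fin n) k)
local notation3 "Bg" => HomogeneousLocalization.Away (reesGrading Ig) (reesT T hT)
local notation3 "φg" => reesChartBase (I := Ig) T hT
local notation3 "Egens" => (({X b ^ 2, X b * X a, X b * X c, X a ^ 2, X a * X c, X c ^ 2} :
    Set (MvPolynomial (Fin n) k)) ∪ (fun i : Fin n => (X i : MvPolynomial (Fin n) k)) '' {i | i ≠ a ∧ i ≠ b ∧ i ≠ c})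
local notation3 "LQ" => Localization.Away Qp
local notation3 "EQ" => Algebra.adjoin k ((algebraMap (MvPolynomial (Fin n) k) LQ) '' Egens ∪
    {(IsLocalization.Away.invSelf Qp : LQ)})

/-- The degree-two numerator `H₃ t²` (`H₃ ∈ I²`) lies in the degree-`2` piece of the Rees algebra. [folklore] -/
theorem monomial_two_mem_reesGrading :
    (⟨monomial 2 H₃, reesAlgebra.monomial_mem.mpr hH₃⟩ : reesAlgebra Ig) ∈ reesGrading Ig (2 • 1) :=
  ⟨H₃, rfl⟩

local notation3 (prettyPrint := false) "θg" =>
  HomogeneousLocalization.Away.mk (reesGrading Ig) (reesT_mem T hT) 2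
    (⟨monomial 2 H₃, reesAlgebra.monomial_mem.mpr hH₃⟩ : reesAlgebra Ig) (monomial_two_mem_reesGrading k n g H₃ hH₃)

/-- The chart map on `θ = (H₃t²)/(Tt)²`: `reesChart θ = H₃/T²` in `k[x][1/T]`. [folklore] -/
theorem reesChart_theta : reesChart T hT θg =
    algebraMap (MvPolynomial (Fin n) k) (Localization.Away T) H₃ * IsLocalization.Away.invSelf T ^ 2 :=
  reesChart_mk T hT (monomial_two_mem_reesGrading k n g H₃ hH₃) rfl

/-- The chart map on a generator `(g_j t)/(T t)`: `reesChart = g_j/T`. [folklore] -/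
theorem reesChart_chartGen (j : Fin m) :
    reesChart T hT (HomogeneousLocalization.Away.mk (reesGrading Ig) (reesT_mem T hT) 1
        (reesT (g j) (Ideal.mem_span_range_self (f := g) (x := j))) (reesT_mem_one_smul g j)) =
      algebraMap (MvPolynomial (Fin n) k) (Localization.Away T) (g j) * IsLocalization.Away.invSelf T := by
  rw [reesChart_mk T hT (reesT_mem_one_smul g j) (coe_reesT _ _), pow_one]

/-- A `k`-algebra map whose values on the variables lie in a subalgebra takes values in it. [folklore] -/
theorem map_mem_of_forall_X_mem (ψ : MvPolynomial (Fin n) k →ₐ[k] MvPolynomial (Fin n) k)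
    (E : Subalgebra k (MvPolynomial (Fin n) k)) (hψE : ∀ i, ψ (X i) ∈ E) (F : MvPolynomial (Fin n) k) :
    ψ F ∈ E := by
  induction F using MvPolynomial.induction_on with
  | C t =>
    rw [← MvPolynomial.algebraMap_eq, AlgHom.commutes]
    exact Subalgebra.algebraMap_mem _ _
  | add p p' hp hq' =>
    rw [map_add]
    exact Subalgebra.add_mem _ hp hq'
  | mul_X p s hp =>
    rw [map_mul]
    exact Subalgebra.mul_mem _ hp (hψE s)

/-- In the Rees chart ring at `T`: `(x tᴺ)/(T t)ᴺ · (Tᴺ/1) = r/1` when `x = r tᴺ`. [folklore] -/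
theorem awayMk_mul_reesChartBase_pow {N : ℕ} {x : reesAlgebra Ig} (hx : x ∈ reesGrading Ig (N • 1))
    {r : MvPolynomial (Fin n) k} (hr : (x : (MvPolynomial (Fin n) k)[X]) = monomial N r) :
    HomogeneousLocalization.Away.mk (reesGrading Ig) (reesT_mem T hT) N x hx * φg (T ^ N) = φg r := by
  apply reesChart_injective T hT
  rw [map_mul, reesChart_mk T hT hx hr, reesChart_reesChartBase, reesChart_reesChartBase, map_pow, mul_assoc,
    ← mul_pow, mul_comm (IsLocalization.Away.invSelf T), IsLocalization.Away.mul_invSelf, one_pow, mul_one]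

set_option maxHeartbeats 400000 in
/-- **Ring maps out of a localisation `C` of the Rees chart ring `B = (R[It])_{(Tt)}` are determined by
their values on `R`** (provided the image of `T` is a non-zero-divisor): every element of `B` becomes an
element of `R` after multiplication by a power of `T/1`. (Used for the equivariance of `Γ(W_T) ≅ E_Q`:
compare `e ∘ σ̃^*` with `Σ_T ∘ e` on `R`.) [folklore] -/
theorem ringHom_ext_of_reesChart {M : Submonoid Bg} (C : Type) [CommRing C] [Algebra Bg C]
    [IsLocalization M C] {D : Type} [CommRing D] (φ₁ φ₂ : C →+* D)
    (hT' : φ₁ ((algebraMap Bg C : Bg →+* C) (φg T)) ∈ nonZeroDivisors D)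
    (h : ∀ F : MvPolynomial (Fin n) k,
      φ₁ ((algebraMap Bg C : Bg →+* C) (φg F)) = φ₂ ((algebraMap Bg C : Bg →+* C) (φg F))) :
    φ₁ = φ₂ := by
  refine IsLocalization.ringHom_ext M (RingHom.ext fun y => ?_)
  obtain ⟨N, x, hx, rfl⟩ := HomogeneousLocalization.Away.mk_surjective (reesGrading Ig) (reesT_mem T hT) y
  obtain ⟨r, hr⟩ := (mem_reesGrading_iff _).mp hx
  have hr' : (x : (MvPolynomial (Fin n) k)[X]) = monomial N r := by rw [← hr, smul_eq_mul, mul_one]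
  have key := awayMk_mul_reesChartBase_pow k n g T hT hx hr'
  have hpow : ∀ φ : C →+* D, φ ((algebraMap Bg C : Bg →+* C) (φg (T ^ N))) =
      φ ((algebraMap Bg C : Bg →+* C) (φg T)) ^ N := fun φ => by
    rw [map_pow (reesChartBase T hT), map_pow (algebraMap Bg C : Bg →+* C), map_pow φ]
  have h1 : φ₁ ((algebraMap Bg C : Bg →+* C) (HomogeneousLocalization.Away.mk (reesGrading Ig)
      (reesT_mem T hT) N x hx)) * φ₁ ((algebraMap Bg C : Bg →+* C) (φg T)) ^ N =
      φ₂ ((algebraMap Bg C : Bg →+* C) (HomogeneousLocalization.Away.mk (reesGrading Ig)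
      (reesT_mem T hT) N x hx)) * φ₁ ((algebraMap Bg C : Bg →+* C) (φg T)) ^ N :=
    calc _ = φ₁ ((algebraMap Bg C : Bg →+* C) (HomogeneousLocalization.Away.mk (reesGrading Ig)
          (reesT_mem T hT) N x hx * φg (T ^ N))) := by rw [← hpow φ₁, map_mul, map_mul]
      _ = φ₂ ((algebraMap Bg C : Bg →+* C) (HomogeneousLocalization.Away.mk (reesGrading Ig)
          (reesT_mem T hT) N x hx * φg (T ^ N))) := by rw [key, h r]
      _ = _ := by rw [map_mul, map_mul, hpow φ₂, h T]
  exact (mul_cancel_right_mem_nonZeroDivisors (pow_mem hT' N)).mp h1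

end TwistEngine

end Summit.ResolutionOfSingularities.ResolutionOfSingularities.Theorems.WildQuotientResolution.JordanFour

end
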